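import Summits.QuantumFields.QCD.Theorems.NestedDissectionSeaCoerciveOfDiluteLineDefs
import Summits.QuantumFields.QCD.Theorems.NestedDissectionSeaCoerciveSeaMeasurableSeparator
import Literature.MathematicalPhysics.QuantumFieldTheory.QCDPhaseQuenched

/-!
# Crux `CoerciveOfDilute` (stmt-QuantumFields-14759), line `Sketch`: stub `stub_coarseOfMomentAndTransfer`

The bookkeeping implication `SheetGreenIntegrable → TorusSheetMoment → WallTransfer → CoarseLaw` of the line `Sketch`
(cards `sea-pays-its-own-poles` + `two-regime-splice`) of the crux
`Summit.QuantumFields.QCD.Theses.NestedDissectionSea.CoerciveOfDilute`; vocabulary module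
`…NestedDissectionSeaCoerciveOfDiluteLineDefs` (`torusSheetGreen`, `TorusSheetMoment`, `WallTransfer`, `CoarseLaw`,
`SheetGreenIntegrable`).

Write `G(U) = (D_T(U, m_f(k))⁻¹)_ΣΣ` for the torus quark propagator at the sea mass compressed to the internal separator
`Σ` of a window box of sides `s`, `wt(U) = ∏_f |det D_T(U, m_f(k))|` for the phase-quenched weight, `Z = ∫ wt dμ_W`,
`P(E) = (∫ 1_E wt dμ_W) / Z`, `E[F] = (∫ F wt dμ_W) / Z` (Bochner conventions, `x / 0 = 0`), and
`HSS(U) = HasSingularSeparator U m_f(k) s (t/s₀)` for the crux's event at level `t`.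

* (M_Σ) `TorusSheetMoment`: `E[‖G‖] ≤ C s₀` on large roughly cubic window boxes, eventually in `k`;
* (T) `WallTransfer`: `P(HSS ∧ ‖G‖ ≤ s₀/(C_w t)) ≤ B t^{α_w}` for the coarse levels `a_k^γ ≤ t ≤ 1`;
* conclusion `CoarseLaw`: `P(HSS) ≤ A t^α` on the same levels, with `A = B + C_w C`, `α = min α_w 1`, `R = max R₁ R₂`,
  `S₀ = max S₁ S₂` and (T)'s `γ`.

Proof. Union bound `{HSS} ⊆ {HSS ∧ ‖G‖ ≤ M} ∪ {M < ‖G‖}` at `M = s₀/(C_w t) > 0` over two MEASURABLE events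
(`measurableSet_hasSingularSeparator`, p132904, and clause (a) of `SheetGreenIntegrable`), in ratio form
(`CensusDominates.ratio_le`: `P(E) ≤ P(A) + P(B)` for measurable `A, B ⊇`-covering `E`, weight measurable and integrable
by `measurable_norm_det_diracMatrix` / `integrable_norm_det_diracMatrix`); Markov in ratio form
`P(M < ‖G‖) ≤ (1/M) E[‖G‖]` (clause (b) of `SheetGreenIntegrable` makes `‖G‖ · wt` integrable; if `Z = 0` every ratio
is the junk `0`); `(1/M) · C s₀ = C_w C t`; finally `B t^{α_w} + C_w C t ≤ (B + C_w C) t^{min α_w 1}` on `(0, 1]`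
(`t > 0` because `t ≥ a_k^γ > 0`). Pure bookkeeping; no physics input. [folklore]
-/

noncomputable section

open scoped BigOperators Classical Matrix.Norms.L2Operator
open MeasureTheory Filter Matrix
open Literature.MathematicalPhysics.QuantumLattice Literature.MathematicalPhysics.QuantumFieldTheory
  Literature.Probability.LatticeModels
open Summit.QuantumFields.QCD.Theorems.NestedDissectionSeaCoerciveSea (measurableSet_hasSingularSeparator)
open Summit.QuantumFields.QCD.Cruxes.CoerciveSea.ChiralityCollapsesPseudospectrum.CensusDominates (ratio_le)

namespace Summit.QuantumFields.QCD.Cruxes.CoerciveOfDilute.SeaPaysPoles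

/-! ## Private helpers: Markov in ratio form, the split, two power laws -/

/-- **Markov in ratio form** (the skeleton's `ratio_markov`, §3 of `Cruxes/CoerciveOfDilute/Lines/Sketch.lean`, for
an arbitrary sub-event of `{M ≤ F}` so that no decidability instance is pinned): for `F, wt ≥ 0` with `F · wt`
integrable, a positive level `M`, a positive normaliser `Z = ∫ wt` and any event `Ev ⊆ {M ≤ F}`,
`P_wt(Ev) ≤ (1/M) · E_wt[F]`. [folklore] -/
private theorem coarseOfMomentAndTransfer_ratio_markov {Ω : Type*} [MeasurableSpace Ω] (μ : Measure Ω)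
    {F wt : Ω → ℝ} (hF : ∀ ω, 0 ≤ F ω) (hwt : ∀ ω, 0 ≤ wt ω) (hint : Integrable (fun ω => F ω * wt ω) μ)
    {M : ℝ} (hM : 0 < M) (hZ : 0 < ∫ ω, wt ω ∂μ) (Ev : Ω → Prop) (hEv : ∀ ω, Ev ω → M ≤ F ω) :
    (∫ ω, (if Ev ω then (1 : ℝ) else 0) * wt ω ∂μ) / (∫ ω, wt ω ∂μ) ≤
      (1 / M) * ((∫ ω, F ω * wt ω ∂μ) / (∫ ω, wt ω ∂μ)) := by
  rw [← mul_div_assoc]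
  refine div_le_div_of_nonneg_right ?_ hZ.le
  rw [← integral_const_mul]
  refine integral_mono_of_nonneg (Filter.Eventually.of_forall fun ω => ?_) (hint.const_mul (1 / M))
    (Filter.Eventually.of_forall fun ω => ?_)
  · show (0 : ℝ) ≤ (if Ev ω then (1 : ℝ) else 0) * wt ω
    split_ifs
    · rw [one_mul]; exact hwt ω
    · rw [zero_mul]
  · show (if Ev ω then (1 : ℝ) else 0) * wt ω ≤ 1 / M * (F ω * wt ω)
    split_ifs with h
    · rw [one_mul, ← mul_assoc]
      have h1 : (1 : ℝ) ≤ 1 / M * F ω := by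
        rw [one_div, ← div_eq_inv_mul, le_div_iff₀ hM, one_mul]; exact hEv ω h
      calc wt ω = 1 * wt ω := (one_mul _).symm
        _ ≤ (1 / M * F ω) * wt ω := mul_le_mul_of_nonneg_right h1 (hwt ω)
    · rw [zero_mul]; exact mul_nonneg (by positivity) (mul_nonneg (hF ω) (hwt ω))

/-- **The split: union bound + Markov, in ratio form.** For a non-negative measurable integrable weight `wt`, an
event `H`, a non-negative measurable `G` with `G · wt` integrable, a level `M > 0` and a MEASURABLE event
`A ⊇ {H ∧ G ≤ M}`: `P_wt(H) ≤ P_wt(A) + (1/M) · E_wt[G]` — the union bound `{H} ⊆ A ∪ {M < G}` over two measurable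
events (`CensusDominates.ratio_le`) and Markov on the second; when the normaliser `∫ wt` vanishes every ratio is the
Bochner junk `0`. [folklore] -/
private theorem coarseOfMomentAndTransfer_split {Ω : Type*} [MeasurableSpace Ω] (μ : Measure Ω)
    {wt G : Ω → ℝ} {H A : Ω → Prop} (hwt0 : ∀ ω, 0 ≤ wt ω) (hwtm : Measurable wt) (hwti : Integrable wt μ)
    {M : ℝ} (hM : 0 < M) (hA : MeasurableSet {ω | A ω}) (hHA : ∀ ω, H ω → G ω ≤ M → A ω) (hGm : Measurable G)
    (hG0 : ∀ ω, 0 ≤ G ω) (hint : Integrable (fun ω => G ω * wt ω) μ) :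
    (∫ ω, (if H ω then (1 : ℝ) else 0) * wt ω ∂μ) / (∫ ω, wt ω ∂μ) ≤
      (∫ ω, (if A ω then (1 : ℝ) else 0) * wt ω ∂μ) / (∫ ω, wt ω ∂μ) +
        (1 / M) * ((∫ ω, G ω * wt ω ∂μ) / (∫ ω, wt ω ∂μ)) := by
  have hsplit := ratio_le μ wt hwt0 hwtm hwti H A (fun ω => M < G ω) hA (measurableSet_lt measurable_const hGm)
    (fun ω hω => (le_or_gt (G ω) M).imp (fun h => hHA ω hω h) id)
  refine hsplit.trans (add_le_add le_rfl ?_)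
  have hZ0 : 0 ≤ ∫ ω, wt ω ∂μ := integral_nonneg hwt0
  rcases hZ0.eq_or_lt with hZ | hZ
  · have h0 : ∫ ω, wt ω ∂μ = 0 := hZ.symm
    simp only [h0, div_zero, mul_zero, le_refl]
  · exact coarseOfMomentAndTransfer_ratio_markov μ hG0 hwt0 hint hM hZ _ fun ω h => h.le

/-- Combining two power laws on `(0,1]`: `C₁ t^α₁ + C₂ t^α₂ ≤ (C₁ + C₂) t^(min α₁ α₂)` for `C₁, C₂ ≥ 0` (copy of
`add_powerLaw_le`, `Cruxes/CoerciveSea/Lines/chirality_collapses_pseudospectrum.lean`). [folklore] -/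
private theorem coarseOfMomentAndTransfer_add_powerLaw_le {t C₁ C₂ α₁ α₂ : ℝ} (ht0 : 0 < t) (ht1 : t ≤ 1)
    (hC₁ : 0 ≤ C₁) (hC₂ : 0 ≤ C₂) :
    C₁ * t ^ α₁ + C₂ * t ^ α₂ ≤ (C₁ + C₂) * t ^ min α₁ α₂ := by
  rw [add_mul]
  exact add_le_add
    (mul_le_mul_of_nonneg_left (Real.rpow_le_rpow_of_exponent_ge ht0 ht1 (min_le_left α₁ α₂)) hC₁)
    (mul_le_mul_of_nonneg_left (Real.rpow_le_rpow_of_exponent_ge ht0 ht1 (min_le_right α₁ α₂)) hC₂)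

/-! ## The stub -/

/-- **Stub `coarseOfMomentAndTransfer` of line `Sketch` (crux stmt-QuantumFields-14759).** The sheet-moment bound
(M_Σ) `TorusSheetMoment` and the wall transfer (T) `WallTransfer` give the separator law on the COARSE levels,
`CoarseLaw`: `P_pq(HasSingularSeparator U m_f(k) s (t/s₀)) ≤ A t^α` for `t ∈ [a_k^γ, 1]` on large roughly cubic window
boxes along every physical-branch admissible regularisation — by the union bound
`{HSS} ⊆ {HSS ∧ ‖G‖ ≤ s₀/(C_w t)} ∪ {s₀/(C_w t) < ‖G‖}` over two measurable events and Markov in ratio form on (M_Σ)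
(`SheetGreenIntegrable` supplies measurability of `‖G‖` and integrability of `‖G‖ · wt`):
`P ≤ B t^{α_w} + C_w C t ≤ (B + C_w C) t^{min α_w 1}`. Witnesses `R = max R₁ R₂`, `S₀ = max S₁ S₂`, `γ =` (T)'s,
`A = B + C_w C`, `α = min α_w 1`. [folklore] -/
theorem stub_coarseOfMomentAndTransfer : SheetGreenIntegrable → TorusSheetMoment → WallTransfer → CoarseLaw := by
  intro hI hM hT Nf reg hNf hms has hcrit ℓ hℓ m hm
  obtain ⟨R₁, hR₁, S₁, C, hC, hkM⟩ := hM Nf reg hNf hms has hcrit ℓ hℓ m hm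
  obtain ⟨R₂, _hR₂, S₂, Cw, hCw, γ, hγ, αw, hαw, B, hB, hkT⟩ := hT Nf reg hNf hms has hcrit ℓ hℓ m hm
  have hCw0 : 0 < Cw := one_pos.trans_le hCw
  refine ⟨max R₁ R₂, lt_max_of_lt_left hR₁, max S₁ S₂, γ, hγ, B + Cw * C, by positivity, min αw 1,
    lt_min hαw one_pos, ?_⟩
  filter_upwards [hkM, hkT] with k hkM hkT S hS
  have hkM' := hkM S ((le_max_left _ _).trans hS)
  have hkT' := hkT S ((le_max_right _ _).trans hS)
  dsimp only at hkM' hkT' ⊢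
  intro s hs hS₀ hcub f t hat ht1
  have hMs := hkM' s hs (fun i => (le_max_left _ _).trans (hS₀ i)) hcub f
  have hTs := hkT' s hs (fun i => (le_max_right _ _).trans (hS₀ i)) hcub f t hat ht1
  clear hkM' hkT' hkM hkT
  -- positivity bookkeeping: `t ≥ a_k^γ > 0`, `s 0 ≥ 2`, the Markov level `M = s₀/(C_w t) > 0`
  have ht0 : 0 < t := (Real.rpow_pos_of_pos (reg.a_pos k) γ).trans_le hat
  have hs0 : (0 : ℝ) < s 0 := by
    have h2 : ((2 : ℕ) : ℝ) ≤ s 0 := by exact_mod_cast (hs 0).1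
    exact lt_of_lt_of_le (by norm_num) h2
  have hMpos : 0 < (s 0 : ℝ) / (Cw * t) := div_pos hs0 (mul_pos hCw0 ht0)
  -- the phase-quenched weight is non-negative, measurable and integrable
  have hwt0 : ∀ U : GaugeConfig 4 (2 * S + 1) (Matrix.specialUnitaryGroup (Fin 3) ℂ),
      0 ≤ ∏ f', ‖fermionDet (wilsonDirac (fundamentalRep (Fin 3)) U (reg.mcrit k + reg.a k * m f' / reg.Zm k) 1)‖ :=
    fun U => Finset.prod_nonneg fun f' _ => norm_nonneg _
  have hwtm : Measurable fun U : GaugeConfig 4 (2 * S + 1) (Matrix.specialUnitaryGroup (Fin 3) ℂ) =>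
      ∏ f', ‖fermionDet (wilsonDirac (fundamentalRep (Fin 3)) U (reg.mcrit k + reg.a k * m f' / reg.Zm k) 1)‖ := by
    simpa only [norm_det_diracMatrix] using
      measurable_norm_det_diracMatrix (S := 2 * S + 1) (fun f' => reg.mcrit k + reg.a k * m f' / reg.Zm k)
  have hwti : Integrable (fun U : GaugeConfig 4 (2 * S + 1) (Matrix.specialUnitaryGroup (Fin 3) ℂ) =>
      ∏ f', ‖fermionDet (wilsonDirac (fundamentalRep (Fin 3)) U (reg.mcrit k + reg.a k * m f' / reg.Zm k) 1)‖)
      (wilsonMeasure (d := 4) (L := 2 * S + 1) (fundamentalRep (Fin 3)) (reg.β k)) := by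
    simpa only [norm_det_diracMatrix] using
      integrable_norm_det_diracMatrix (S := 2 * S + 1) (fun f' => reg.mcrit k + reg.a k * m f' / reg.Zm k)
        (wilsonMeasure (d := 4) (L := 2 * S + 1) (fundamentalRep (Fin 3)) (reg.β k))
  -- the two measurable events and the integrable Markov integrand (`SheetGreenIntegrable`)
  have hH := measurableSet_hasSingularSeparator (2 * S + 1) (reg.mcrit k + reg.a k * m f / reg.Zm k) s (t / s 0)
  have hGm := hI.1 (2 * S + 1) (reg.mcrit k + reg.a k * m f / reg.Zm k) s
  have hint := hI.2 (2 * S + 1) (reg.β k) Nf (fun f' => reg.mcrit k + reg.a k * m f' / reg.Zm k) s f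
  have hA : MeasurableSet {U : GaugeConfig 4 (2 * S + 1) (Matrix.specialUnitaryGroup (Fin 3) ℂ) |
      HasSingularSeparator U (reg.mcrit k + reg.a k * m f / reg.Zm k) s (t / s 0) ∧
        ‖torusSheetGreen U (reg.mcrit k + reg.a k * m f / reg.Zm k) s‖ ≤ (s 0 : ℝ) / (Cw * t)} :=
    hH.inter (measurableSet_le hGm measurable_const)
  have hsplit := coarseOfMomentAndTransfer_split
    (wilsonMeasure (d := 4) (L := 2 * S + 1) (fundamentalRep (Fin 3)) (reg.β k))
    (H := fun U => HasSingularSeparator U (reg.mcrit k + reg.a k * m f / reg.Zm k) s (t / s 0))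
    hwt0 hwtm hwti hMpos hA (fun U hU hG => ⟨hU, hG⟩) hGm (fun U => norm_nonneg _) hint
  -- assemble: `P(HSS) ≤ B t^αw + (1/M) · C s₀ = B t^αw + C_w C t ≤ (B + C_w C) t^(min αw 1)`
  calc _ ≤ _ := hsplit
    _ ≤ B * t ^ αw + 1 / ((s 0 : ℝ) / (Cw * t)) * (C * s 0) :=
        add_le_add hTs (mul_le_mul_of_nonneg_left hMs (by positivity))
    _ = B * t ^ αw + Cw * C * t ^ (1 : ℝ) := by
        rw [Real.rpow_one]
        field_simp
    _ ≤ (B + Cw * C) * t ^ min αw 1 :=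
        coarseOfMomentAndTransfer_add_powerLaw_le ht0 ht1 hB (mul_nonneg hCw0.le hC.le)

end Summit.QuantumFields.QCD.Cruxes.CoerciveOfDilute.SeaPaysPoles

end
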